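import Summits.QuantumFields.YangMills.Theorems.BalabanLadderIROddTorusLargeFieldRarityRep
import Summits.QuantumFields.YangMills.Theorems.BalabanLadderIRStubRungStrong
import Literature.MathematicalPhysics.QuantumLattice.ContinuumLimitLGT
import Literature.MathematicalPhysics.QuantumLattice.LatticeGaugeDLRFreeEnergyProofs
import Literature.Probability.LatticeModels.LroInfraredBound
import HarnessLib

/-!
# The torus anchor of the typical-data shell condition for the typicality event «small cell action»

Support file (seat ym-infvol-p3, fleet R136 (i); bears on crux `IR` = stmt-QuantumFields-19354, registered line
«af-pincer-T» (planner ym-beyond-p2 g24, `line-af-pincer-T.reg.lean`, stubs `stub_onsetT` / `stub_typCriterion` /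
`stub_afOnsetT`): clause (iii_T) of `TypShellCond`; count-neutral helper).

Clause (iii_T) of `TypShellCond ρ β b n ε δ` asks, for the prover's typicality events `Typ c ⊆ LGConfig 4 G` of the
cells `c` of a mesh-`b` grid `w`: «on every odd torus `2S+1 ≥ 4b`, for every finite set `F` of cells inside the
fundamental domain `[-S, S]⁴`, `μ_{2S+1,β} {V | ∀ c ∈ F, torusLift V ∉ Typ c} ≤ δ ^ #F`», with `δ` fixed BEFORE `S`.
This file provides that clause for the natural typicality event

  `smallActionTyp ρ w T c = {σ | ∑_{q ∈ cellPlaqs w c} (N - Re tr ρ(σ_q)) < T}`  (the cell's Wilson action is `< T`),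

together with its measurability and cell-locality (`measurableSet_smallActionTyp`, `dependsOn_smallActionTyp` — the
first two conjuncts of `TypShellCond` for this `Typ`), from the hereditary large-field rarity on odd tori
`measureReal_forall_le_cellAction_le_pow_rep` (`…OddTorusLargeFieldRarityRep`): the cells inside `[-S, S]⁴` project
injectively to the torus (`torusProj_injOn_box`), the lifted cell actions are torus cell actions
(`plaquetteHolonomyZd_torusLift`), different cells have disjoint plaquette sets, a cell has at most `(2b)⁴ · m`
plaquettes (`m = #orientations`), and the base
`δ(β, b, T) = m · exp(-βT/(2m²) + (2b)⁴ m (K₀ + D log β)/m)` does not depend on `S`, `w` or `F`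
(`torusAnchor_smallActionTyp`, Chebyshev parameter `λ = β/2`).

HONEST FRAMING: this is the soft clause (iii_T) for ONE choice of `Typ`; the kernel-level rarity (ii_T) and the
typical-data mixing (i_T) — the content of `stub_onsetT` — are NOT addressed; nothing here bears on the mass gap or Clay.
-/

noncomputable section

open MeasureTheory Finset
open Literature.MathematicalPhysics
open Literature.MathematicalPhysics.QuantumFieldTheory Literature.MathematicalPhysics.QuantumLattice
open Summit.QuantumFields.YangMills.Cruxes.IR.Tempered (cellEdges)

namespace Summit.QuantumFields.YangMills.Theorems.OddTorusChessboard

variable {G : Type} [Group G] [TopologicalSpace G] [IsTopologicalGroup G] [CompactSpace G]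
  [MeasurableSpace G] [BorelSpace G]

/-! ### §1. Cells, their plaquettes, the cell action, the typicality event -/

/-- The sites of the grid cell `c`: `∏ᵢ [w i (c i), w i (c i + 1))` (so that `cellEdges w c = cellSites w c ×ˢ univ`). -/
def cellSites (w : Fin 4 → ℤ → ℤ) (c : Fin 4 → ℤ) : Finset (Fin 4 → ℤ) :=
  Fintype.piFinset fun i : Fin 4 => Finset.Ico (w i (c i)) (w i (c i + 1))

/-- The plaquettes of the cell: base point and the two shifted corners `x + eᵢ`, `x + eⱼ` in the cell (hence all four
links of the plaquette are links of the cell). -/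
def cellPlaqs (w : Fin 4 → ℤ → ℤ) (c : Fin 4 → ℤ) : Finset (ZdPlaquette 4) :=
  (cellSites w c ×ˢ (Finset.univ : Finset {p : Fin 4 × Fin 4 // p.1 < p.2})).filter fun q =>
    q.1 + Pi.single q.2.1.1 1 ∈ cellSites w c ∧ q.1 + Pi.single q.2.1.2 1 ∈ cellSites w c

/-- The Wilson action of the cell: `∑_{q ∈ cellPlaqs w c} (N - Re tr ρ(σ_q))`. -/
def cellActionZd {N : ℕ} (ρ : G →* Matrix (Fin N) (Fin N) ℂ) (w : Fin 4 → ℤ → ℤ) (c : Fin 4 → ℤ)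
    (σ : LGConfig 4 G) : ℝ :=
  ∑ q ∈ cellPlaqs w c, ((N : ℝ) - plaquetteObs ρ q.1 q.2.1.1 q.2.1.2 σ)

/-- **The typicality event «small cell action»**: the cell's Wilson action is `< T`. -/
def smallActionTyp {N : ℕ} (ρ : G →* Matrix (Fin N) (Fin N) ℂ) (w : Fin 4 → ℤ → ℤ) (T : ℝ) (c : Fin 4 → ℤ) :
    Set (LGConfig 4 G) :=
  {σ | cellActionZd ρ w c σ < T}

omit [TopologicalSpace G] [IsTopologicalGroup G] [CompactSpace G] [MeasurableSpace G] [BorelSpace G] in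
/-- Membership in `cellSites`. -/
theorem mem_cellSites {w : Fin 4 → ℤ → ℤ} {c : Fin 4 → ℤ} {x : Fin 4 → ℤ} :
    x ∈ cellSites w c ↔ ∀ i, w i (c i) ≤ x i ∧ x i < w i (c i + 1) := by
  simp [cellSites, Fintype.mem_piFinset]

omit [TopologicalSpace G] [IsTopologicalGroup G] [CompactSpace G] [MeasurableSpace G] [BorelSpace G] in
/-- A plaquette of the cell has its base point in the cell. -/
theorem fst_mem_cellSites_of_mem_cellPlaqs {w : Fin 4 → ℤ → ℤ} {c : Fin 4 → ℤ} {q : ZdPlaquette 4}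
    (hq : q ∈ cellPlaqs w c) : q.1 ∈ cellSites w c :=
  (Finset.mem_product.1 (Finset.mem_filter.1 hq).1).1

omit [CompactSpace G] in
/-- **(first conjunct)** the typicality event is measurable. -/
theorem measurableSet_smallActionTyp [SecondCountableTopology G] {N : ℕ} (ρ : G →* Matrix (Fin N) (Fin N) ℂ)
    (hρ : Continuous ρ) (w : Fin 4 → ℤ → ℤ) (T : ℝ) (c : Fin 4 → ℤ) :
    MeasurableSet (smallActionTyp (G := G) ρ w T c) :=
  measurableSet_lt (Finset.measurable_sum _ fun q _ =>
    measurable_const.sub (measurable_plaquetteObs ρ hρ q.1 q.2.1.1 q.2.1.2)) measurable_const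

omit [TopologicalSpace G] [IsTopologicalGroup G] [CompactSpace G] [MeasurableSpace G] [BorelSpace G] in
/-- The cell action depends only on the links of the cell. -/
theorem dependsOn_cellActionZd {N : ℕ} (ρ : G →* Matrix (Fin N) (Fin N) ℂ) (w : Fin 4 → ℤ → ℤ) (c : Fin 4 → ℤ) :
    DependsOn (cellActionZd (G := G) ρ w c) (↑(cellEdges w c) : Set (QuantumLattice.ZdEdge 4)) := by
  intro U V hUV
  unfold cellActionZd
  refine Finset.sum_congr rfl fun q hq => ?_
  obtain ⟨hq1, hqi, hqj⟩ : q.1 ∈ cellSites w c ∧ q.1 + Pi.single q.2.1.1 1 ∈ cellSites w c ∧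
      q.1 + Pi.single q.2.1.2 1 ∈ cellSites w c :=
    ⟨fst_mem_cellSites_of_mem_cellPlaqs hq, (Finset.mem_filter.1 hq).2⟩
  have hE : ∀ x ∈ cellSites w c, ∀ k : Fin 4, ((x, k) : QuantumLattice.ZdEdge 4) ∈ (↑(cellEdges w c) : Set (QuantumLattice.ZdEdge 4)) := by
    intro x hx k
    rw [Finset.mem_coe]
    exact Finset.mem_product.2 ⟨hx, Finset.mem_univ _⟩
  congr 1
  simp only [plaquetteObs, plaquetteHolonomyZd]
  rw [hUV _ (hE _ hq1 _), hUV _ (hE _ hqi _), hUV _ (hE _ hqj _), hUV (q.1, q.2.1.2) (hE _ hq1 _)]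

omit [TopologicalSpace G] [IsTopologicalGroup G] [CompactSpace G] [MeasurableSpace G] [BorelSpace G] in
/-- **(second conjunct)** the typicality event is read off the cell's own links. -/
theorem dependsOn_smallActionTyp {N : ℕ} (ρ : G →* Matrix (Fin N) (Fin N) ℂ) (w : Fin 4 → ℤ → ℤ) (T : ℝ)
    (c : Fin 4 → ℤ) :
    DependsOn (fun σ : LGConfig 4 G => σ ∈ smallActionTyp ρ w T c) (↑(cellEdges w c) : Set (QuantumLattice.ZdEdge 4)) := by
  intro U V hUV
  simp only [smallActionTyp, Set.mem_setOf_eq, dependsOn_cellActionZd ρ w c hUV]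

/-! ### §2. Geometry of the cells of a grid inside the fundamental domain -/

omit [TopologicalSpace G] [IsTopologicalGroup G] [CompactSpace G] [MeasurableSpace G] [BorelSpace G] in
/-- A grid line is monotone. -/
theorem grid_monotone {w : Fin 4 → ℤ → ℤ} {b : ℕ}
    (hw : ∀ i j, w i j + ((b : ℕ) : ℤ) ≤ w i (j + 1) ∧ w i (j + 1) ≤ w i j + 2 * ((b : ℕ) : ℤ)) (i : Fin 4) :
    Monotone (w i) :=
  monotone_int_of_le_succ fun j => by have := (hw i j).1; omega

omit [TopologicalSpace G] [IsTopologicalGroup G] [CompactSpace G] [MeasurableSpace G] [BorelSpace G] in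
/-- Distinct cells of a grid have disjoint site boxes. -/
theorem disjoint_cellSites {w : Fin 4 → ℤ → ℤ} {b : ℕ}
    (hw : ∀ i j, w i j + ((b : ℕ) : ℤ) ≤ w i (j + 1) ∧ w i (j + 1) ≤ w i j + 2 * ((b : ℕ) : ℤ))
    {c c' : Fin 4 → ℤ} (hcc : c ≠ c') : Disjoint (cellSites w c) (cellSites w c') := by
  obtain ⟨i, hi⟩ : ∃ i, c i ≠ c' i := by
    by_contra h
    push Not at h
    exact hcc (funext h)
  rw [Finset.disjoint_left]
  intro x hx hx'
  rw [mem_cellSites] at hx hx'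
  have hm := grid_monotone hw i
  rcases lt_or_gt_of_ne hi with hlt | hlt
  · have h1 : w i (c i + 1) ≤ w i (c' i) := hm (by omega)
    have := (hx i).2; have := (hx' i).1; omega
  · have h1 : w i (c' i + 1) ≤ w i (c i) := hm (by omega)
    have := (hx i).1; have := (hx' i).2; omega

omit [TopologicalSpace G] [IsTopologicalGroup G] [CompactSpace G] [MeasurableSpace G] [BorelSpace G] in
/-- A cell has at most `(2b)⁴` sites. -/
theorem card_cellSites_le {w : Fin 4 → ℤ → ℤ} {b : ℕ}
    (hw : ∀ i j, w i j + ((b : ℕ) : ℤ) ≤ w i (j + 1) ∧ w i (j + 1) ≤ w i j + 2 * ((b : ℕ) : ℤ)) (c : Fin 4 → ℤ) :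
    #(cellSites w c) ≤ (2 * b) ^ 4 := by
  unfold cellSites
  rw [Fintype.card_piFinset]
  have h : ∀ i : Fin 4, (Finset.Ico (w i (c i)) (w i (c i + 1))).card ≤ 2 * b := fun i => by
    rw [Int.card_Ico]
    refine Int.toNat_le.2 ?_
    have := (hw i (c i)).2
    push_cast
    omega
  calc ∏ i : Fin 4, (Finset.Ico (w i (c i)) (w i (c i + 1))).card ≤ ∏ _i : Fin 4, 2 * b :=
        Finset.prod_le_prod' fun i _ => h i
    _ = (2 * b) ^ 4 := by rw [Finset.prod_const, Finset.card_univ, Fintype.card_fin]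

omit [TopologicalSpace G] [IsTopologicalGroup G] [CompactSpace G] [MeasurableSpace G] [BorelSpace G] in
/-- A cell has at most `(2b)⁴ · m` plaquettes. -/
theorem card_cellPlaqs_le {w : Fin 4 → ℤ → ℤ} {b : ℕ}
    (hw : ∀ i j, w i j + ((b : ℕ) : ℤ) ≤ w i (j + 1) ∧ w i (j + 1) ≤ w i j + 2 * ((b : ℕ) : ℤ)) (c : Fin 4 → ℤ) :
    #(cellPlaqs w c) ≤ (2 * b) ^ 4 * Fintype.card (Orient 4) := by
  unfold cellPlaqs
  refine (Finset.card_filter_le _ _).trans ?_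
  rw [Finset.card_product, Finset.card_univ]
  exact Nat.mul_le_mul_right _ (card_cellSites_le hw c)

omit [TopologicalSpace G] [IsTopologicalGroup G] [CompactSpace G] [MeasurableSpace G] [BorelSpace G] in
/-- A cell inside the fundamental domain `[-S, S]⁴` has its sites in the centred box. -/
theorem cellSites_subset_box {w : Fin 4 → ℤ → ℤ} {c : Fin 4 → ℤ} {S : ℕ}
    (hin : ∀ i, -(S : ℤ) ≤ w i (c i) ∧ w i (c i + 1) ≤ (S : ℤ) + 1) :
    ∀ x ∈ cellSites w c, x ∈ Literature.Probability.LatticeModels.box 4 S := by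
  intro x hx
  rw [mem_cellSites] at hx
  rw [Literature.Probability.LatticeModels.mem_box]
  intro i
  have := hx i; have := hin i
  constructor <;> omega

/-! ### §3. The torus anchor -/

/-- Projection of a plaquette of `ℤ⁴` to the torus of side `L`. -/
def projPlaq (L : ℕ) (q : ZdPlaquette 4) : Plaquette 4 L :=
  (Literature.Probability.LatticeModels.Torus.proj L q.1, q.2)

omit [TopologicalSpace G] [IsTopologicalGroup G] [CompactSpace G] [MeasurableSpace G] [BorelSpace G] in
/-- The projection is injective on the plaquettes based in the centred box `[-S, S]⁴` of the torus of side `2S+1`. -/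
theorem projPlaq_injOn_box (S : ℕ) {q q' : ZdPlaquette 4}
    (hq : q.1 ∈ Literature.Probability.LatticeModels.box 4 S) (hq' : q'.1 ∈ Literature.Probability.LatticeModels.box 4 S)
    (h : projPlaq (2 * S + 1) q = projPlaq (2 * S + 1) q') : q = q' := by
  have h' : Literature.Probability.LatticeModels.Torus.proj (2 * S + 1) q.1 =
      Literature.Probability.LatticeModels.Torus.proj (2 * S + 1) q'.1 ∧ q.2 = q'.2 := by
    simpa [projPlaq, Prod.mk.injEq] using h
  obtain ⟨h1, h2⟩ := h'
  exact Prod.ext (Literature.Probability.LatticeModels.torusProj_injOn_box (by omega) hq hq' h1) h2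

omit [TopologicalSpace G] [IsTopologicalGroup G] [CompactSpace G] [MeasurableSpace G] [BorelSpace G] in
/-- The lifted cell action is the torus cell action of the projected plaquettes. -/
theorem cellActionZd_torusLift {N : ℕ} (ρ : G →* Matrix (Fin N) (Fin N) ℂ) {w : Fin 4 → ℤ → ℤ} {c : Fin 4 → ℤ}
    {S : ℕ} (hin : ∀ i, -(S : ℤ) ≤ w i (c i) ∧ w i (c i + 1) ≤ (S : ℤ) + 1)
    (V : GaugeConfig 4 (2 * S + 1) G) :
    cellActionZd ρ w c (torusLift (2 * S + 1) V) =
      ∑ q ∈ (cellPlaqs w c).image (projPlaq (2 * S + 1)), plaquetteCost ρ V q := by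
  unfold cellActionZd
  rw [Finset.sum_image fun q hq q' hq' h => projPlaq_injOn_box S
    (cellSites_subset_box hin _ (fst_mem_cellSites_of_mem_cellPlaqs hq))
    (cellSites_subset_box hin _ (fst_mem_cellSites_of_mem_cellPlaqs hq')) h]
  refine Finset.sum_congr rfl fun q _ => ?_
  rw [plaquetteObs, FreeEnergy.plaquetteHolonomyZd_torusLift]
  rfl

/-- **The torus anchor (clause (iii_T) of `TypShellCond`) for the typicality event «small cell action».**  For every
lattice representation `r : LatticeRep G` there are `K₀, D` such that for all `β ≥ 1`, all meshes `b ≥ 1`, all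
thresholds `T` and every mesh-`b` grid `w`, with
`δ = m · exp(-(β/2)·T/m² + ((2b)⁴ m) (K₀ + D log β)/m)` (`m = #orientations`), on every odd torus `2S+1 ≥ 4b` and for
every finite set `F` of cells inside `[-S, S]⁴`:
`μ_{2S+1,β} {V | ∀ c ∈ F, torusLift V ∉ smallActionTyp r.ρ w T c} ≤ ENNReal.ofReal (δ ^ #F)`. -/
theorem torusAnchor_smallActionTyp (r : LatticeRep G) :
    ∃ K₀ : ℝ, ∃ D : ℕ, ∀ (β : ℝ), 1 ≤ β → ∀ (b : ℕ), 1 ≤ b → ∀ (T : ℝ) (w : Fin 4 → ℤ → ℤ),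
      (∀ i j, w i j + ((b : ℕ) : ℤ) ≤ w i (j + 1) ∧ w i (j + 1) ≤ w i j + 2 * ((b : ℕ) : ℤ)) →
        ∀ S : ℕ, 4 * b ≤ 2 * S + 1 → ∀ F : Finset (Fin 4 → ℤ),
          (∀ c ∈ F, ∀ i, -(S : ℤ) ≤ w i (c i) ∧ w i (c i + 1) ≤ (S : ℤ) + 1) →
            (wilsonMeasure (d := 4) (L := 2 * S + 1) r.ρ β)
                {V : GaugeConfig 4 (2 * S + 1) G | ∀ c ∈ F, torusLift (2 * S + 1) V ∉ smallActionTyp r.ρ w T c} ≤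
              ENNReal.ofReal (((Fintype.card (Orient 4) : ℝ) *
                Real.exp (-(β / 2 * T) / (Fintype.card (Orient 4) : ℝ) ^ 2 +
                  (((2 * b) ^ 4 * Fintype.card (Orient 4) : ℕ) : ℝ) * (K₀ + D * Real.log β) /
                    Fintype.card (Orient 4))) ^ #F) := by
  classical
  obtain ⟨K₀, D, h⟩ := measureReal_forall_le_cellAction_le_pow_rep r
  refine ⟨K₀, D, fun β hβ b hb T w hw S hS F hin => ?_⟩
  have hL : Odd (2 * S + 1) := ⟨S, rfl⟩
  have hL3 : 3 ≤ 2 * S + 1 := by omega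
  haveI := isProbabilityMeasure_wilsonMeasure (d := 4) (L := 2 * S + 1) (G := G) r.ρ r.continuous β
  -- the torus cells
  set P : (Fin 4 → ℤ) → Finset (Plaquette 4 (2 * S + 1)) := fun c => (cellPlaqs w c).image (projPlaq (2 * S + 1))
    with hP
  have hdisj : ∀ c ∈ F, ∀ c' ∈ F, c ≠ c' → Disjoint (P c) (P c') := by
    intro c hc c' hc' hcc
    rw [Finset.disjoint_left]
    intro q hq hq'
    obtain ⟨z, hz, rfl⟩ := Finset.mem_image.1 hq
    obtain ⟨z', hz', hzz⟩ := Finset.mem_image.1 hq'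
    have hz1 := fst_mem_cellSites_of_mem_cellPlaqs hz
    have hz'1 := fst_mem_cellSites_of_mem_cellPlaqs hz'
    have heq : z' = z := projPlaq_injOn_box S (cellSites_subset_box (hin c' hc') _ hz'1)
      (cellSites_subset_box (hin c hc) _ hz1) hzz
    rw [heq] at hz'1
    exact Finset.disjoint_left.1 (disjoint_cellSites hw hcc) hz1 hz'1
  have hn : ∀ c ∈ F, #(P c) ≤ (2 * b) ^ 4 * Fintype.card (Orient 4) := fun c _ =>
    Finset.card_image_le.trans (card_cellPlaqs_le hw c)
  -- the event, rewritten on the torus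
  have hev : {V : GaugeConfig 4 (2 * S + 1) G | ∀ c ∈ F, torusLift (2 * S + 1) V ∉ smallActionTyp r.ρ w T c} =
      {V | ∀ c ∈ F, T ≤ ∑ q ∈ P c, plaquetteCost r.ρ V q} := by
    ext V
    simp only [Set.mem_setOf_eq, smallActionTyp, not_lt]
    refine forall₂_congr fun c hc => ?_
    rw [cellActionZd_torusLift r.ρ (hin c hc) V]
  have hmain := h hL hL3 β hβ (β / 2) (by linarith) (by linarith) F P hdisj ((2 * b) ^ 4 * Fintype.card (Orient 4)) hn T
  rw [hev, ← ofReal_measureReal]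
  refine ENNReal.ofReal_le_ofReal (hmain.trans (le_of_eq ?_))
  congr 3

end Summit.QuantumFields.YangMills.Theorems.OddTorusChessboard

end
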